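import Literature.MathematicalPhysics.QuantumLattice.LatticeWilsonFlow
import Literature.Analysis.Calculus.ClosedSubgroupExpChart
import HarnessLib

/-!
# First-order condition of gauge-minimality (Fermat in a one-parameter gauge direction)
# (route-independent helper toward the crux `TwistExponentGap.RigidTwistCeiling` ⟨stmt-QuantumFields-24054⟩, step (W3); free hands
# of width seat ym-line-sfw-p2-w3)

In the local Morse–Bott inequality one first moves the configuration `U` by the gauge transformation that MINIMISES the
Hilbert–Schmidt distance to the twisted-flat centre `U₀` (compactness of the lattice gauge group); along every one-parameter gauge
direction `t ↦ exp(tη_x)` the distance `Σ_e ‖a_e − e^{tP_e}e^{tQ_e}‖²` is then minimal at `t = 0`, and Fermat's theorem gives the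
ORTHOGONALITY of the residual to the linearised gauge direction: `Σ_e Re tr((a_e − 1)† (P_e + Q_e)) = 0`
(`sum_inner_eq_zero_of_isMinOn_exp_mul_exp`; `P_e = η_{s(e)}`, `Q_e = −Ad_{U₀(e)} η_{t(e)}` in the application).  Stated for an arbitrary
finite index type and arbitrary matrices, in trace form (the real Frobenius inner product `frobeniusInnerProductSpace` of the tree is used
only inside the proof, via `letI`).
HONEST FRAMING: elementary calculus; nothing here bears on a summit statement or on the Yang–Mills mass gap.
-/

set_option autoImplicit false

noncomputable section

open scoped Matrix Matrix.Norms.Frobenius RealInnerProductSpace BigOperators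
open NormedSpace
open Literature.MathematicalPhysics.QuantumLattice

namespace Summit.QuantumFields.YangMills.Theorems.TwistExponentGap

/-- Derivative at `0` of `t ↦ e^{tP} e^{tQ}`: it is `P + Q`. -/
theorem hasDerivAt_exp_smul_mul_exp_smul_zero {N : ℕ} (P Q : Matrix (Fin N) (Fin N) ℂ) :
    HasDerivAt (fun t : ℝ => exp (t • P) * exp (t • Q)) (P + Q) 0 := by
  have hP : HasDerivAt (fun t : ℝ => exp (t • P)) P 0 :=
    (hasDerivAt_exp_smul_const' (𝕂 := ℝ) P (0 : ℝ)).congr_deriv (by rw [zero_smul, exp_zero, mul_one])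
  have hQ : HasDerivAt (fun t : ℝ => exp (t • Q)) Q 0 :=
    (hasDerivAt_exp_smul_const' (𝕂 := ℝ) Q (0 : ℝ)).congr_deriv (by rw [zero_smul, exp_zero, mul_one])
  exact (hP.fun_mul hQ).congr_deriv (by simp)

/-- **Fermat for a gauge-minimal configuration.**  If `t ↦ Σ_e ‖a_e − e^{tP_e}e^{tQ_e}‖²` (Frobenius norms) is minimal at `t = 0`,
then `Σ_e ⟪a_e − 1, P_e + Q_e⟫ = 0` for the real Frobenius inner product. -/
theorem sum_inner_eq_zero_of_isMinOn_exp_mul_exp {N : ℕ} {ι : Type*} [Fintype ι]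
    (a P Q : ι → Matrix (Fin N) (Fin N) ℂ)
    (hmin : ∀ t : ℝ, ∑ e, ‖a e - 1‖ ^ 2 ≤ ∑ e, ‖a e - exp (t • P e) * exp (t • Q e)‖ ^ 2) :
    ∑ e, (Matrix.trace ((a e - 1)ᴴ * (P e + Q e))).re = 0 := by
  letI : InnerProductSpace ℝ (Matrix (Fin N) (Fin N) ℂ) := frobeniusInnerProductSpace
  show ∑ e, ⟪a e - 1, P e + Q e⟫ = 0
  -- the function and its derivative at `0`
  set φ : ℝ → ℝ := fun t => ∑ e, ‖a e - exp (t • P e) * exp (t • Q e)‖ ^ 2 with hφ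
  have hderiv : HasDerivAt φ (∑ e, 2 * ⟪a e - 1, -(P e + Q e)⟫) 0 := by
    have hterm : ∀ e, HasDerivAt (fun t : ℝ => ‖a e - exp (t • P e) * exp (t • Q e)‖ ^ 2)
        (2 * ⟪a e - 1, -(P e + Q e)⟫) 0 := by
      intro e
      have h1 : HasDerivAt (fun t : ℝ => a e - exp (t • P e) * exp (t • Q e)) (-(P e + Q e)) 0 :=
        (hasDerivAt_exp_smul_mul_exp_smul_zero (P e) (Q e)).const_sub (a e)
      exact h1.norm_sq.congr_deriv (by simp)
    rw [hφ]
    exact HasDerivAt.fun_sum (u := Finset.univ) (fun e _ => hterm e)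
  -- `0` is a minimum of `φ`
  have hmin0 : IsLocalMin φ 0 := by
    refine Filter.Eventually.of_forall fun t => ?_
    have h0 : φ 0 = ∑ e, ‖a e - 1‖ ^ 2 := by simp [hφ]
    rw [h0]
    exact hmin t
  have h := hmin0.hasDerivAt_eq_zero hderiv
  -- `Σ 2 ⟪a_e − 1, −(P_e+Q_e)⟫ = −2 Σ ⟪a_e − 1, P_e + Q_e⟫`
  have h2 : ∑ e, 2 * ⟪a e - 1, -(P e + Q e)⟫ = -2 * ∑ e, ⟪a e - 1, P e + Q e⟫ := by
    rw [Finset.mul_sum]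
    refine Finset.sum_congr rfl fun e _ => ?_
    rw [inner_neg_right]; ring
  rw [h2] at h
  linarith

end Summit.QuantumFields.YangMills.Theorems.TwistExponentGap

end
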